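import Literature.Topology.PlanarFoliations.CirclePowers
import Literature.Topology.PlaneTopology.LoopWinding
import Literature.Topology.PlaneTopology.WindingPowers
import HarnessLib

/-!
# Loops of a circle of degree `±1`, read on plane winding numbers

Topic: Topology / PlanarFoliations (generic circle topology, sequel to `CirclePowers.lean`) and
PlaneTopology (`LoopWinding.lean`, `WindingPowers.lean`). Let the circle `Y` be parametrised by the
injective loop `β` and mapped to the plane by `Φ`. Every loop `h` of `Y` at `β 0` is homotopic to a
power `β^d` (`exists_homotopic_loopPow`), and **the winding numbers of `Φ ∘ h` are `d` times those
of `Φ ∘ β`** (`wind_pathLoop_sub_eq_mul`). Hence **if `Φ ∘ h` has different winding numbers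
`w₋ - w₊ = ±1` about two points off `Φ(Y)`, one of which (`p₂`) has winding number `0` for
`Φ ∘ β`, then `d = ±1`: `h` is homotopic to `β` or to its reverse**
(`homotopic_loop_or_symm_of_wind`), and then **the image of `h` under any map is null-homotopic
iff the image of `β` is** (`map_loop_homotopic_refl_iff_of_wind`). This is how the loops of a
compact leaf tracked along a hugged separatrix graph are shown to be generators (degree `±1`).

All statements are [folklore].
-/

noncomputable section

open Set Function unitInterval
open _root_.Topology
open Literature.Topology.PlaneTopology

namespace Literature.Topology.PlanarFoliations

namespace CircleLoops

variable {Y : Type*} [TopologicalSpace Y] [T2Space Y] {Z : Type*} [TopologicalSpace Z] {β : ℝ → Y}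

omit [T2Space Y] in
/-- **The winding numbers of the image of a loop homotopic to `β^d` are `d` times those of the
image of `β`.** [folklore] -/
theorem wind_pathLoop_sub_eq_mul (hc : Continuous β) (hp : Periodic β 1) {Φ : Y → ℂ} (hΦ : Continuous Φ)
    {h : Path (β 0) (β 0)} {d : ℤ} (hd : h.Homotopic (loopPow hc hp d)) {p : ℂ} (hp' : ∀ y, Φ y ≠ p) :
    wind (fun t ↦ pathLoop Φ h t - p) = d * wind (fun t ↦ Φ (β t) - p) := by
  rw [wind_pathLoop_eq_of_homotopic hΦ hd hp']
  have heq : ∀ t ∈ Icc (0 : ℝ) 1, pathLoop Φ (loopPow hc hp d) t - p = (fun u ↦ Φ (β u) - p) (d * t) := fun t ht ↦ by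
    rw [pathLoop_apply_of_mem _ _ ht, loopPow_apply]
  rw [wind_congr heq]
  exact wind_comp_intCast_mul (f := fun u ↦ Φ (β u) - p) ((hΦ.comp hc).sub continuous_const)
    (fun t ↦ sub_ne_zero.2 (hp' _)) (fun t ↦ by simp only [hp t]) d

/-- **A loop whose image winds `±1` more about `p₁` than about `p₂`, where the image of `β` does
not wind about `p₂`, is homotopic to `β` or to its reverse.** [folklore] -/
theorem homotopic_loop_or_symm_of_wind (hc : Continuous β) (hp : Periodic β 1) (hinj : InjOn β (Ico 0 1))
    (hsurj : range β = univ) {Φ : Y → ℂ} (hΦ : Continuous Φ) (h : Path (β 0) (β 0)) {p₁ p₂ : ℂ}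
    (hq₁ : ∀ y, Φ y ≠ p₁) (hq₂ : ∀ y, Φ y ≠ p₂)
    (hjump : wind (fun t ↦ pathLoop Φ h t - p₁) - wind (fun t ↦ pathLoop Φ h t - p₂) = 1 ∨
      wind (fun t ↦ pathLoop Φ h t - p₁) - wind (fun t ↦ pathLoop Φ h t - p₂) = -1)
    (hout : wind (fun t ↦ Φ (β t) - p₂) = 0) :
    h.Homotopic (loop hc hp) ∨ h.Homotopic (loop hc hp).symm := by
  obtain ⟨d, hd⟩ := exists_homotopic_loopPow hc hp hinj hsurj h
  rw [wind_pathLoop_sub_eq_mul hc hp hΦ hd hq₁, wind_pathLoop_sub_eq_mul hc hp hΦ hd hq₂, hout, mul_zero, sub_zero] at hjump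
  -- `d * w₋ = ±1`: `d = ±1`
  have hd1 : d = 1 ∨ d = -1 := by
    rcases hjump with hj | hj
    · exact Int.eq_one_or_neg_one_of_mul_eq_one hj
    · exact Int.eq_one_or_neg_one_of_mul_eq_one (v := -wind (fun t ↦ Φ (β t) - p₁)) (by rw [mul_neg, hj, neg_neg])
  rcases hd1 with h1 | h1
  · left; rw [h1, loopPow_one] at hd; exact hd
  · right; rw [h1, loopPow_neg, loopPow_one] at hd; exact hd

/-- **For such a loop, the image under any map is null-homotopic iff the image of `β` is.**
[folklore] -/
theorem map_loop_homotopic_refl_iff_of_wind (hc : Continuous β) (hp : Periodic β 1) (hinj : InjOn β (Ico 0 1))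
    (hsurj : range β = univ) {Φ : Y → ℂ} (hΦ : Continuous Φ) (h : Path (β 0) (β 0)) {p₁ p₂ : ℂ}
    (hq₁ : ∀ y, Φ y ≠ p₁) (hq₂ : ∀ y, Φ y ≠ p₂)
    (hjump : wind (fun t ↦ pathLoop Φ h t - p₁) - wind (fun t ↦ pathLoop Φ h t - p₂) = 1 ∨
      wind (fun t ↦ pathLoop Φ h t - p₁) - wind (fun t ↦ pathLoop Φ h t - p₂) = -1)
    (hout : wind (fun t ↦ Φ (β t) - p₂) = 0) (Ψ : C(Y, Z)) :
    (h.map Ψ.continuous).Homotopic (Path.refl _) ↔ ((loop hc hp).map Ψ.continuous).Homotopic (Path.refl _) := by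
  rcases homotopic_loop_or_symm_of_wind hc hp hinj hsurj hΦ h hq₁ hq₂ hjump hout with hh | hh
  · constructor
    · exact fun hn ↦ (hh.map Ψ).symm.trans hn
    · exact fun hn ↦ (hh.map Ψ).trans hn
  · have hmap : (loop hc hp).symm.map Ψ.continuous = ((loop hc hp).map Ψ.continuous).symm := rfl
    constructor
    · intro hn
      have h1 : (((loop hc hp).map Ψ.continuous).symm).Homotopic (Path.refl _) := by
        rw [← hmap]; exact (hh.map Ψ).symm.trans hn
      have h2 := h1.symm₂
      simpa using h2
    · intro hn
      have h1 : (((loop hc hp).map Ψ.continuous).symm).Homotopic (Path.refl _) := by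
        simpa using hn.symm₂
      rw [← hmap] at h1
      exact (hh.map Ψ).trans h1

end CircleLoops

end Literature.Topology.PlanarFoliations
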